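import Summits.HubbardSuperconductivity.HubbardSuperconductivity.Theorems.AnisotropyChordTransferFibre3FinXC2Eval
import Summits.HubbardSuperconductivity.HubbardSuperconductivity.Theorems.AnisotropyChordTransferFibre3FinXB2Cert

/-!
# Route `AnisotropyChord` / H0 rotor rung: FIN mid-`L` COMBINED certificate XBC2 — the cell certificate is sound

Soundness of `…FinXC2Eval.xbcCellOK2` (XBC2 analogue of g5's `…FinXCCell.xbc_cell_sound`): the `T⁺` brackets from the XB2
objects (`tPlusLo_le2`, `le_tPlusHi2`), the row-C objects transferred verbatim (`xcObj`'s `M`, `Chi`, `Nhi`, `η` do not read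
the row-`N₁` objects; the scalars of XB2 are g5's), and ★★ `xbc2_cell_sound`: row `N₁` (`c·U ≤ N₁`, by `xb2_cell_sound`) and the
row-C bracket tuple of `KT2Assembly.offPoleTailAbs_of_brackets` (`b = bn/bd`) for every ground profile of the cell.
Prover seat `hubbard-h0-rotor-p3` g6; helper for piece A = stmt-HubbardSuperconductivity-23918 of rung 19089 (`--supports`, helper
class).  WHAT THIS IS NOT: nothing here proves superconductivity in the Hubbard model (rotor TARGET as worded stays FALSE, g15 verdict);
two hypotheses (rows `N₁`, C per `L` per cell) of ONE conditional reduction.  Tree imports only; no sorry, no new axioms.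
-/

set_option linter.dupNamespace false
set_option autoImplicit false

namespace Summit.HubbardSuperconductivity.HubbardSuperconductivity.Theorems.AnisotropyChord.Transfer.Fibre3

namespace FinXB

open scoped BigOperators
open Finset Hole2 FinCell

variable {L : ℕ} [NeZero L]

/-- `tPlusLo/D ≤ T⁺` from the XB2 objects. [folklore] -/
theorem tPlusLo_le2 {Δ lam2 : ℝ} {f : Tor L → ℝ} {la lb : ℤ} (H : CellHyp2 (L := L) Δ lam2 f la lb)
    (hP : 0 < (xbEval2 L la lb (tWedgePt L la) (tWedgePt L lb)).2.P.1) :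
    ((tPlusLo (xbEval2 L la lb (tWedgePt L la) (tWedgePt L lb)).1 (xbEval2 L la lb (tWedgePt L la) (tWedgePt L lb)).2 : ℤ) : ℝ)
      ≤ Tplus L Δ f * ((D : ℤ) : ℝ) := by
  have hD := D_pos
  set S := (xbEval2 L la lb (tWedgePt L la) (tWedgePt L lb)).1
  set O := (xbEval2 L la lb (tWedgePt L la) (tWedgePt L lb)).2
  have mP := H.mem_objP; have mQ := H.mem_objQ
  have mlam : mem lam2 S.lam := H.toCellHyp.hS.1
  have hPlo : 0 < (O.P.1 : ℝ) / ((D : ℤ) : ℝ) := by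
    have : (0 : ℝ) < (O.P.1 : ℝ) := by exact_mod_cast hP
    positivity
  have hP2pos : 0 < O.P.2 := by
    have : (O.P.1 : ℝ) ≤ (O.P.2 : ℝ) := mP.1.trans mP.2
    have : O.P.1 ≤ O.P.2 := by exact_mod_cast this
    omega
  have hP1 : (O.P.1 : ℝ) / ((D : ℤ) : ℝ) ≤ PiNormSq L f := by rw [div_le_iff₀ hD]; exact mP.1
  have hP2 : PiNormSq L f ≤ (O.P.2 : ℝ) / ((D : ℤ) : ℝ) := by rw [le_div_iff₀ hD]; exact mP.2
  have hQ1 : (O.Q.1 : ℝ) / ((D : ℤ) : ℝ) ≤ ∑ c : Cfg L, piR L f c * C0fn L Δ lam2 f c := by rw [div_le_iff₀ hD]; exact mQ.1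
  have hQ2 : ∑ c : Cfg L, piR L f c * C0fn L Δ lam2 f c ≤ (O.Q.2 : ℝ) / ((D : ℤ) : ℝ) := by rw [le_div_iff₀ hD]; exact mQ.2
  have hT := (KT1Assembly.Tplus_bracket L H.hf.1 hPlo hP1 hP2 hQ1 hQ2).1
  have u1 := (mem_iscale 3 mlam).1
  have u2 := (mem_imul (mem_ipt O.Q.1) (mem_iinv (mem_ipt O.P.1) (by exact hP))).1
  have u3 := (mem_imul (mem_ipt O.Q.1) (mem_iinv (mem_ipt O.P.2) (by exact hP2pos))).1
  unfold tPlusLo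
  push_cast
  push_cast at u1 u2 u3
  rw [← div_eq_mul_one_div] at u2 u3
  have hmin : min (((imul (ipt O.Q.1) (iinv (ipt O.P.1))).1 : ℤ) : ℝ) (((imul (ipt O.Q.1) (iinv (ipt O.P.2))).1 : ℤ) : ℝ)
      ≤ min ((O.Q.1 : ℝ) / ((D : ℤ) : ℝ) / ((O.P.1 : ℝ) / ((D : ℤ) : ℝ)))
            ((O.Q.1 : ℝ) / ((D : ℤ) : ℝ) / ((O.P.2 : ℝ) / ((D : ℤ) : ℝ))) * ((D : ℤ) : ℝ) := by
    rw [min_mul_of_nonneg _ _ hD.le]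
    exact min_le_min u2 u3
  nlinarith [hmin, u1, hT]

/-- `T⁺ ≤ tPlusHi/D` from the XB2 objects. [folklore] -/
theorem le_tPlusHi2 {Δ lam2 : ℝ} {f : Tor L → ℝ} {la lb : ℤ} (H : CellHyp2 (L := L) Δ lam2 f la lb)
    (hP : 0 < (xbEval2 L la lb (tWedgePt L la) (tWedgePt L lb)).2.P.1) :
    Tplus L Δ f * ((D : ℤ) : ℝ)
      ≤ ((tPlusHi (xbEval2 L la lb (tWedgePt L la) (tWedgePt L lb)).1 (xbEval2 L la lb (tWedgePt L la) (tWedgePt L lb)).2 : ℤ) : ℝ) := by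
  have hD := D_pos
  set S := (xbEval2 L la lb (tWedgePt L la) (tWedgePt L lb)).1
  set O := (xbEval2 L la lb (tWedgePt L la) (tWedgePt L lb)).2
  have mP := H.mem_objP; have mQ := H.mem_objQ
  have mlam : mem lam2 S.lam := H.toCellHyp.hS.1
  have hPlo : 0 < (O.P.1 : ℝ) / ((D : ℤ) : ℝ) := by
    have : (0 : ℝ) < (O.P.1 : ℝ) := by exact_mod_cast hP
    positivity
  have hP2pos : 0 < O.P.2 := by
    have : (O.P.1 : ℝ) ≤ (O.P.2 : ℝ) := mP.1.trans mP.2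
    have : O.P.1 ≤ O.P.2 := by exact_mod_cast this
    omega
  have hP1 : (O.P.1 : ℝ) / ((D : ℤ) : ℝ) ≤ PiNormSq L f := by rw [div_le_iff₀ hD]; exact mP.1
  have hP2 : PiNormSq L f ≤ (O.P.2 : ℝ) / ((D : ℤ) : ℝ) := by rw [le_div_iff₀ hD]; exact mP.2
  have hQ1 : (O.Q.1 : ℝ) / ((D : ℤ) : ℝ) ≤ ∑ c : Cfg L, piR L f c * C0fn L Δ lam2 f c := by rw [div_le_iff₀ hD]; exact mQ.1
  have hQ2 : ∑ c : Cfg L, piR L f c * C0fn L Δ lam2 f c ≤ (O.Q.2 : ℝ) / ((D : ℤ) : ℝ) := by rw [le_div_iff₀ hD]; exact mQ.2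
  have hT := (KT1Assembly.Tplus_bracket L H.hf.1 hPlo hP1 hP2 hQ1 hQ2).2
  have u1 := (mem_iscale 3 mlam).2
  have u2 := (mem_imul (mem_ipt O.Q.2) (mem_iinv (mem_ipt O.P.1) (by exact hP))).2
  have u3 := (mem_imul (mem_ipt O.Q.2) (mem_iinv (mem_ipt O.P.2) (by exact hP2pos))).2
  unfold tPlusHi
  push_cast
  push_cast at u1 u2 u3
  rw [← div_eq_mul_one_div] at u2 u3
  have hmax : max ((O.Q.2 : ℝ) / ((D : ℤ) : ℝ) / ((O.P.1 : ℝ) / ((D : ℤ) : ℝ)))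
        ((O.Q.2 : ℝ) / ((D : ℤ) : ℝ) / ((O.P.2 : ℝ) / ((D : ℤ) : ℝ))) * ((D : ℤ) : ℝ)
      ≤ max (((imul (ipt O.Q.2) (iinv (ipt O.P.1))).2 : ℤ) : ℝ) (((imul (ipt O.Q.2) (iinv (ipt O.P.2))).2 : ℤ) : ℝ) := by
    rw [max_mul_of_nonneg _ _ hD.le]
    exact max_le_max u2 u3
  nlinarith [hmax, u1, hT]

/-- the row-C objects `M, Chi, Nhi, η` do not read the row-`N₁` objects. [folklore] -/
theorem xcObj_indep (L : ℕ) (la lb : ℤ) (S : XBScal) (O O' : XBObj) :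
    (xcObj L la lb S O').M = (xcObj L la lb S O).M ∧ (xcObj L la lb S O').chi = (xcObj L la lb S O).chi ∧
    (xcObj L la lb S O').nhi = (xcObj L la lb S O).nhi ∧ (xcObj L la lb S O').eta = (xcObj L la lb S O).eta := by
  unfold xcObj
  exact ⟨rfl, rfl, rfl, rfl⟩

/-- ★★ THE COMBINED XBC2 CELL CERTIFICATE IS SOUND: row `N₁` (`c·U ≤ N₁`) and the row-C bracket tuple of
`KT2Assembly.offPoleTailAbs_of_brackets` (`b = bn/bd`) for every ground profile of the cell. [folklore] -/
theorem xbc2_cell_sound (hL : 5 ≤ L) {Δ lam2 : ℝ} (hΔ0 : 0 < Δ) (hΔ1 : Δ < 1) {f : Tor L → ℝ}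
    (hf : IsGroundTwoMagnon L Δ lam2 f) {la lb : ℤ}
    (hla : (la : ℝ) ≤ lam2 * ((D : ℤ) : ℝ)) (hlb : lam2 * ((D : ℤ) : ℝ) ≤ (lb : ℝ))
    {c : ℚ} {bn bd : ℕ} (hcert : xbcCellOK2 L la lb c bn bd (tWedgePt L la) (tWedgePt L lb) = true) :
    CellConclusion L Δ lam2 f c bn bd := by
  set E := xbEval2 L la lb (tWedgePt L la) (tWedgePt L lb) with hEdef
  have hsplit : xbCellOK2 L la lb c (tWedgePt L la) (tWedgePt L lb) = true ∧
      (0 < bd ∧ xcMok L (fTab4 L la lb) (xcObj L la lb E.1 E.2).M = true ∧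
        0 ≤ (xcObj L la lb E.1 E.2).tlo ∧ (xcObj L la lb E.1 E.2).thi ≤ 2 * E.1.eps1.1 ∧
        0 ≤ (xcObj L la lb E.1 E.2).eta.1 ∧
        sqSum (xcObj L la lb E.1 E.2) ≤ rhsLo L E.1 (xcObj L la lb E.1 E.2) bn bd) := by
    unfold xbcCellOK2 at hcert
    unfold xbCellOK2
    simp only [Bool.and_eq_true, decide_eq_true_eq] at hcert ⊢
    exact ⟨hcert.1, hcert.2.1.1.1.1.1, hcert.2.1.1.1.1.2, hcert.2.1.1.1.2, hcert.2.1.1.2, hcert.2.1.2, hcert.2.2⟩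
  obtain ⟨hN1, hbd, hMok, htlo0, hthi, heta0, hineq⟩ := hsplit
  refine ⟨xb2_cell_sound hL hΔ0.le hΔ1 hf hla hlb hN1, ?_⟩
  have hcert' := hN1
  unfold xbCellOK2 at hcert'
  simp only [Bool.and_eq_true, decide_eq_true_eq] at hcert'
  obtain ⟨⟨⟨⟨⟨hchk, hsc⟩, hna⟩, hP⟩, -⟩, -⟩ := hcert'
  have H : CellHyp2 (L := L) Δ lam2 f la lb := ⟨⟨hL, hΔ0.le, hΔ1, hf, hla, hlb, hchk, hsc⟩, hna⟩
  have hD := D_pos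
  set S := E.1 with hSdef
  set O := E.2 with hOdef
  set C := xcObj L la lb S O with hCdef
  -- the row-C objects are those of g5 (same scalars; `M, Chi, Nhi, η` independent of the row-`N₁` objects)
  have hind := xcObj_indep L la lb S O (xbEval L la lb).2
  have hMok' : xcMok L (fTab4 L la lb) (xcObj L la lb (xbEval L la lb).1 (xbEval L la lb).2).M = true := by
    have e : (xbEval L la lb).1 = S := rfl
    rw [e, hind.1]; exact hMok
  obtain ⟨Chi, Nhi, hChi, hNhi, hChi0, hNhi0, mChi, mNhi, mEta⟩ := xcObj_sound H.toCellHyp hMok'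
  have eS : (xbEval L la lb).1 = S := rfl
  rw [eS] at mChi mNhi mEta
  rw [hind.2.1] at mChi
  rw [hind.2.2.1] at mNhi
  rw [hind.2.2.2] at mEta
  have hTlo := tPlusLo_le2 H hP
  have hThi := le_tPlusHi2 H hP
  have mlam : mem lam2 S.lam := H.toCellHyp.hS.1
  have meps : mem (eps1 L) S.eps1 := H.toCellHyp.hS.2.2.2.2.2.2.2.2.2.2
  refine ⟨Chi, Nhi, 0, 0, (C.tlo : ℝ) / ((D : ℤ) : ℝ), (C.thi : ℝ) / ((D : ℤ) : ℝ), hChi, hNhi,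
    polePartNonneg_holds L Δ f, lowNormPartNonneg_holds L Δ f, ?_, ?_, ?_, ?_, ?_⟩
  · rw [div_le_iff₀ hD]; exact hTlo
  · rw [le_div_iff₀ hD]; exact hThi
  · have h1 : ((C.thi : ℤ) : ℝ) ≤ 2 * ((S.eps1.1 : ℤ) : ℝ) := by exact_mod_cast hthi
    rw [div_le_iff₀ hD]
    nlinarith [meps.1]
  · have : (0 : ℝ) ≤ ((C.tlo : ℤ) : ℝ) := by exact_mod_cast htlo0
    positivity
  · rw [sub_zero, sub_zero]
    have ms := mem_iadd (mem_iscale 3 (mem_isqrt (Real.sqrt_nonneg Chi) (by rw [Real.sq_sqrt hChi0]; exact mChi)))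
      (mem_iscale 3 (mem_isqrt (Real.sqrt_nonneg Nhi) (by rw [Real.sq_sqrt hNhi0]; exact mNhi)))
    set s := iadd (iscale 3 (isqrt C.chi)) (iscale 3 (isqrt C.nhi)) with hsdef
    obtain ⟨-, hs2⟩ := ms
    push_cast at hs2
    have hv0 : 0 ≤ 3 * Real.sqrt Chi + 3 * Real.sqrt Nhi := by positivity
    have hvle : 3 * Real.sqrt Chi + 3 * Real.sqrt Nhi ≤ (s.2 : ℝ) / ((D : ℤ) : ℝ) := by
      rw [le_div_iff₀ hD]; exact hs2
    have e2 := (mem_imul (mem_ipt s.2) (mem_ipt s.2)).2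
    have hsq : (3 * Real.sqrt Chi + 3 * Real.sqrt Nhi) ^ 2 * ((D : ℤ) : ℝ) ≤ ((sqSum C : ℤ) : ℝ) := by
      have hle : (3 * Real.sqrt Chi + 3 * Real.sqrt Nhi) ^ 2 ≤ ((s.2 : ℝ) / ((D : ℤ) : ℝ)) * ((s.2 : ℝ) / ((D : ℤ) : ℝ)) := by
        rw [sq]; exact mul_le_mul hvle hvle hv0 (hv0.trans hvle)
      unfold sqSum
      exact (mul_le_mul_of_nonneg_right hle hD.le).trans e2
    have mR := mem_idivn (mem_iscale (bn * (3 * (L * L) ^ 2))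
      (mem_imul (mem_imul (mem_ipt C.eta.1) (mem_isub (mem_iscale 2 (mem_ipt S.eps1.1)) (mem_ipt C.thi))) (mem_ipt C.tlo)))
      (show (0 : ℤ) < (bd : ℤ) by exact_mod_cast hbd)
    obtain ⟨hRlo, -⟩ := mR
    have hineqR : ((sqSum C : ℤ) : ℝ) ≤ ((rhsLo L S C bn bd : ℤ) : ℝ) := by exact_mod_cast hineq
    unfold rhsLo at hineqR
    have hEta : ((C.eta.1 : ℤ) : ℝ) / ((D : ℤ) : ℝ) ≤ (L : ℝ) ^ 2 * lam2 / 4 := by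
      rw [div_le_iff₀ hD]; have := mEta.1; unfold etaEff at this; exact this
    have hEta0 : 0 ≤ ((C.eta.1 : ℤ) : ℝ) / ((D : ℤ) : ℝ) := by
      have : (0 : ℝ) ≤ ((C.eta.1 : ℤ) : ℝ) := by exact_mod_cast heta0
      positivity
    have hEps : ((S.eps1.1 : ℤ) : ℝ) / ((D : ℤ) : ℝ) ≤ eps1 L := by rw [div_le_iff₀ hD]; exact meps.1
    have hThi' : ((C.thi : ℤ) : ℝ) / ((D : ℤ) : ℝ) ≤ 2 * (((S.eps1.1 : ℤ) : ℝ) / ((D : ℤ) : ℝ)) := by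
      rw [div_le_iff₀ hD]
      have h1 : ((C.thi : ℤ) : ℝ) ≤ 2 * ((S.eps1.1 : ℤ) : ℝ) := by exact_mod_cast hthi
      have : 2 * (((S.eps1.1 : ℤ) : ℝ) / ((D : ℤ) : ℝ)) * ((D : ℤ) : ℝ) = 2 * ((S.eps1.1 : ℤ) : ℝ) := by
        field_simp
      linarith
    have hTlo0 : 0 ≤ ((C.tlo : ℤ) : ℝ) / ((D : ℤ) : ℝ) := by
      have : (0 : ℝ) ≤ ((C.tlo : ℤ) : ℝ) := by exact_mod_cast htlo0
      positivity
    have hbn : (0 : ℝ) ≤ bn := by positivity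
    have hbd' : (0 : ℝ) < bd := by exact_mod_cast hbd
    have hmono :
        ((bn * (3 * (L * L) ^ 2) : ℕ) : ℝ) *
            ((((C.eta.1 : ℤ) : ℝ) / ((D : ℤ) : ℝ)) * (((2 : ℕ) : ℝ) * (((S.eps1.1 : ℤ) : ℝ) / ((D : ℤ) : ℝ))
              - ((C.thi : ℤ) : ℝ) / ((D : ℤ) : ℝ)) * (((C.tlo : ℤ) : ℝ) / ((D : ℤ) : ℝ))) / ((bd : ℤ) : ℝ)
          ≤ ((bn : ℝ) / bd) * ((L : ℝ) ^ 2 * lam2 / 4) * (2 * eps1 L - ((C.thi : ℤ) : ℝ) / ((D : ℤ) : ℝ))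
              * (3 * ((L : ℝ) ^ 2) ^ 2 * (((C.tlo : ℤ) : ℝ) / ((D : ℤ) : ℝ))) := by
      have hA : (((C.eta.1 : ℤ) : ℝ) / ((D : ℤ) : ℝ)) * (((2 : ℕ) : ℝ) * (((S.eps1.1 : ℤ) : ℝ) / ((D : ℤ) : ℝ))
              - ((C.thi : ℤ) : ℝ) / ((D : ℤ) : ℝ))
          ≤ ((L : ℝ) ^ 2 * lam2 / 4) * (2 * eps1 L - ((C.thi : ℤ) : ℝ) / ((D : ℤ) : ℝ)) := by
        push_cast
        exact mul_le_mul hEta (by linarith) (by linarith) ((hEta0).trans hEta)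
      have hB := mul_le_mul_of_nonneg_right hA hTlo0
      have hC := mul_le_mul_of_nonneg_left hB (show (0 : ℝ) ≤ ((bn * (3 * (L * L) ^ 2) : ℕ) : ℝ) / ((bd : ℤ) : ℝ) by
        push_cast; positivity)
      have e1 : ((bn * (3 * (L * L) ^ 2) : ℕ) : ℝ) *
            ((((C.eta.1 : ℤ) : ℝ) / ((D : ℤ) : ℝ)) * (((2 : ℕ) : ℝ) * (((S.eps1.1 : ℤ) : ℝ) / ((D : ℤ) : ℝ))
              - ((C.thi : ℤ) : ℝ) / ((D : ℤ) : ℝ)) * (((C.tlo : ℤ) : ℝ) / ((D : ℤ) : ℝ))) / ((bd : ℤ) : ℝ)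
          = ((bn * (3 * (L * L) ^ 2) : ℕ) : ℝ) / ((bd : ℤ) : ℝ) *
            ((((C.eta.1 : ℤ) : ℝ) / ((D : ℤ) : ℝ)) * (((2 : ℕ) : ℝ) * (((S.eps1.1 : ℤ) : ℝ) / ((D : ℤ) : ℝ))
              - ((C.thi : ℤ) : ℝ) / ((D : ℤ) : ℝ)) * (((C.tlo : ℤ) : ℝ) / ((D : ℤ) : ℝ))) := by ring
      have e2 : ((bn * (3 * (L * L) ^ 2) : ℕ) : ℝ) / ((bd : ℤ) : ℝ) *
            (((L : ℝ) ^ 2 * lam2 / 4) * (2 * eps1 L - ((C.thi : ℤ) : ℝ) / ((D : ℤ) : ℝ)) * (((C.tlo : ℤ) : ℝ) / ((D : ℤ) : ℝ)))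
          = ((bn : ℝ) / bd) * ((L : ℝ) ^ 2 * lam2 / 4) * (2 * eps1 L - ((C.thi : ℤ) : ℝ) / ((D : ℤ) : ℝ))
              * (3 * ((L : ℝ) ^ 2) ^ 2 * (((C.tlo : ℤ) : ℝ) / ((D : ℤ) : ℝ))) := by push_cast; ring
      rw [e1]; rw [e2] at hC; exact hC
    have key : (3 * Real.sqrt Chi + 3 * Real.sqrt Nhi) ^ 2 * ((D : ℤ) : ℝ)
        ≤ ((bn : ℝ) / bd) * ((L : ℝ) ^ 2 * lam2 / 4) * (2 * eps1 L - ((C.thi : ℤ) : ℝ) / ((D : ℤ) : ℝ))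
              * (3 * ((L : ℝ) ^ 2) ^ 2 * (((C.tlo : ℤ) : ℝ) / ((D : ℤ) : ℝ))) * ((D : ℤ) : ℝ) := by
      refine hsq.trans (hineqR.trans (hRlo.trans ?_))
      exact mul_le_mul_of_nonneg_right hmono hD.le
    exact le_of_mul_le_mul_right key hD

end FinXB

end Summit.HubbardSuperconductivity.HubbardSuperconductivity.Theorems.AnisotropyChord.Transfer.Fibre3
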